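import Mathlib.AlgebraicGeometry.Morphisms.Flat
import Mathlib.AlgebraicGeometry.IdealSheaf.Functorial
import Mathlib.RingTheory.Flat.FaithfullyFlat.Algebra
import HarnessLib

/-!
# Pulling back quasi-coherent ideal sheaves along affine, faithfully flat and closed morphisms

Topic: `Literature/AlgebraicGeometry/Resolution`. Elementary descent lemmas for Mathlib's
quasi-coherent ideal sheaves (`Scheme.IdealSheafData`; `J.comap f` is the ideal sheaf `J·𝒪_X` of
`X ×_Y V(J)`, `I.map f` the largest ideal sheaf whose pullback is `≤ I`), used by the limit /
descent arguments of de Jong 1996, 4.5 (`FiniteSubextensionTower.lean`,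
`StrictNormalCrossingsDescent.lean`, `AlterationsDescentProofs.lean`):

* `ideal_comap_preimage_of_isAffineHom` — for an affine `f : X → Y` and an affine open `U ⊆ Y`,
  `(J·𝒪_X)(f⁻¹U) = J(U)·Γ(X, f⁻¹U)` (`Spec A ×_{Spec R} Spec R/I = Spec A/IA`; the sections of a
  fibre product over affine opens are the tensor product, Mathlib
  `isIso_pushoutSection_of_isAffineOpen`);
* `faithfullyFlat_app` — for `f` affine, flat and surjective, `Γ(Y, U) → Γ(X, f⁻¹U)` is
  faithfully flat; hence (`IB ∩ A = I`) pulling back ideal sheaves along `f` is injective and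
  order-reflecting and radicality descends (`comap_injective`, `le_of_comap_le_comap`,
  `eq_bot_of_comap_eq_bot`, `radical_eq_of_comap`);
* supports: `image_support_comap`, `eq_vanishingIdeal_support`;
* closed immersions: `comap_map_of_isClosedImmersion` (every ideal sheaf of the source is pulled
  back from its pushforward) and `comap_vanishingIdeal_image_of_isClosedImmersion` (the ideal of
  the reduced structure on `D` is pulled back from that on `c(D)`).

All statements are standard (EGA I 9.1, EGA IV₂ 2.2; faithfully flat descent of ideals,
Matsumura Thm. 7.5). [folklore]
-/

noncomputable section

open CategoryTheory CategoryTheory.Limits AlgebraicGeometry TopologicalSpace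

namespace Literature.AlgebraicGeometry.Resolution

universe u

/-! ## Pulling back ideal sheaves along affine and faithfully flat morphisms -/

section IdealSheaves

open Scheme.IdealSheafData

variable {X Y : Scheme.{u}}

/-- **Pullback of an ideal sheaf along an affine morphism, on affine opens**: for an affine
morphism `f : X → Y`, an ideal sheaf `J` on `Y` and an affine open `U ⊆ Y`, the sections over
the affine open `f⁻¹U` of the pullback ideal sheaf `J·𝒪_X` (`J.comap f`, the ideal of
`X ×_Y V(J)`) are the extension `J(U)·Γ(X, f⁻¹U)` of `J(U)` along `Γ(Y, U) → Γ(X, f⁻¹U)`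
(`Spec A ×_{Spec R} Spec R/I = Spec A/IA`). [folklore] -/
theorem ideal_comap_preimage_of_isAffineHom (J : Y.IdealSheafData)
    (f : X ⟶ Y) [IsAffineHom f] (U : Y.affineOpens) :
    (J.comap f).ideal ⟨f ⁻¹ᵁ U, U.2.preimage f⟩ = (J.ideal U).map (f.app U).hom := by
  apply le_antisymm
  · intro s hs
    -- notation
    let ι := J.subschemeι
    let g := pullback.fst f ι
    have H : IsPullback g (pullback.snd f ι) f ι := IsPullback.of_hasPullback f ι
    let UY : (pullback f ι).Opens := g ⁻¹ᵁ (f ⁻¹ᵁ U) ⊓ (pullback.snd f ι) ⁻¹ᵁ (ι ⁻¹ᵁ U)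
    have hiso := isIso_pushoutSection_of_isAffineOpen H (US := U.1) (UT := ι ⁻¹ᵁ U)
      (UX := f ⁻¹ᵁ U) le_rfl le_rfl (UY := UY) rfl U.2 (U.2.preimage ι) (U.2.preimage f)
    -- `s` is killed by `g.app (f⁻¹U)`, hence by `g.appLE (f⁻¹U) UY`
    have hs' : (g.app (f ⁻¹ᵁ U)).hom s = 0 := by
      have : (J.comap f).ideal ⟨f ⁻¹ᵁ U, U.2.preimage f⟩ = RingHom.ker (g.app (f ⁻¹ᵁ U)).hom :=
        Scheme.Hom.ker_apply g ⟨f ⁻¹ᵁ U, U.2.preimage f⟩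
      rw [this] at hs
      exact hs
    have hs'' : (g.appLE (f ⁻¹ᵁ U) UY inf_le_left).hom s = 0 := by
      rw [Scheme.Hom.appLE, CommRingCat.hom_comp, RingHom.comp_apply, hs', map_zero]
    -- hence by `pushout.inl` (the sections of the fibre product are the pushout of the sections)
    have hinl : (pushout.inl (f.appLE U.1 (f ⁻¹ᵁ U) le_rfl) (ι.appLE U.1 (ι ⁻¹ᵁ U) le_rfl)).hom
        s = 0 := by
      have e : pushout.inl _ _ ≫ pushoutSection H (US := U.1) (UT := ι ⁻¹ᵁ U)
          (UX := f ⁻¹ᵁ U) le_rfl le_rfl (UY := UY) rfl = g.appLE (f ⁻¹ᵁ U) UY (by simp [UY]) :=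
        pushout.inl_desc _ _ _
      apply (ConcreteCategory.bijective_of_isIso (pushoutSection H (US := U.1) (UT := ι ⁻¹ᵁ U)
          (UX := f ⁻¹ᵁ U) le_rfl le_rfl (UY := UY) rfl)).1
      rw [map_zero, ← RingHom.comp_apply, ← CommRingCat.hom_comp, e]
      exact hs''
    -- compare with the cocone `Γ(X, f⁻¹U) → Γ(X, f⁻¹U)/J(U)Γ(X, f⁻¹U) ← Γ(V(J), ι⁻¹U)`
    let A := Γ(X, f ⁻¹ᵁ U)
    let I : Ideal A := (J.ideal U).map (f.app U).hom
    have hsurj : Function.Surjective (ι.appLE U.1 (ι ⁻¹ᵁ U) le_rfl).hom := by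
      rw [← Scheme.Hom.app_eq_appLE]
      exact J.subschemeι_app_surjective U
    have hker : RingHom.ker (ι.appLE U.1 (ι ⁻¹ᵁ U) le_rfl).hom ≤
        RingHom.ker ((Ideal.Quotient.mk I).comp (f.appLE U.1 (f ⁻¹ᵁ U) le_rfl).hom) := by
      intro r hr
      rw [← Scheme.Hom.app_eq_appLE] at hr
      have hr' : r ∈ J.ideal U := by
        rw [← J.ker_subschemeι_app U]
        exact hr
      rw [RingHom.mem_ker, RingHom.comp_apply, Ideal.Quotient.eq_zero_iff_mem,
        ← Scheme.Hom.app_eq_appLE]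
      exact Ideal.mem_map_of_mem _ hr'
    let l : Γ(J.subscheme, ι ⁻¹ᵁ U) →+* A ⧸ I :=
      (ι.appLE U.1 (ι ⁻¹ᵁ U) le_rfl).hom.liftOfSurjective hsurj ⟨_, hker⟩
    have hl : l.comp (ι.appLE U.1 (ι ⁻¹ᵁ U) le_rfl).hom =
        (Ideal.Quotient.mk I).comp (f.appLE U.1 (f ⁻¹ᵁ U) le_rfl).hom :=
      RingHom.liftOfRightInverse_comp _ _ _ _
    let d : pushout (f.appLE U.1 (f ⁻¹ᵁ U) le_rfl) (ι.appLE U.1 (ι ⁻¹ᵁ U) le_rfl) ⟶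
        CommRingCat.of (A ⧸ I) :=
      pushout.desc (CommRingCat.ofHom (Ideal.Quotient.mk I)) (CommRingCat.ofHom l) (by
        ext r : 2
        change ((Ideal.Quotient.mk I).comp (f.appLE U.1 (f ⁻¹ᵁ U) le_rfl).hom) r =
          (l.comp (ι.appLE U.1 (ι ⁻¹ᵁ U) le_rfl).hom) r
        rw [hl])
    have hd : pushout.inl _ _ ≫ d = CommRingCat.ofHom (Ideal.Quotient.mk I) :=
      pushout.inl_desc _ _ _
    have : Ideal.Quotient.mk I s = 0 := by
      change (CommRingCat.ofHom (Ideal.Quotient.mk I)).hom s = 0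
      rw [← hd, CommRingCat.hom_comp, RingHom.comp_apply, hinl, map_zero]
    exact Ideal.Quotient.eq_zero_iff_mem.mp this
  · rw [Ideal.map_le_iff_le_comap, ← ideal_map_of_isAffineHom]
    exact (le_map_comap J f) U

/-- For a flat surjective affine morphism `f : X → Y` and an affine open `U ⊆ Y`, the ring map
`Γ(Y, U) → Γ(X, f⁻¹U)` is faithfully flat. [folklore] -/
theorem faithfullyFlat_app (f : X ⟶ Y) [IsAffineHom f] [Flat f] [Surjective f]
    (U : Y.affineOpens) : (f.app U).hom.FaithfullyFlat := by
  rw [RingHom.FaithfullyFlat.iff_flat_and_comap_surjective]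
  have hV : IsAffineOpen (f ⁻¹ᵁ U) := U.2.preimage f
  refine ⟨?_, ?_⟩
  · rw [Scheme.Hom.app_eq_appLE]
    exact f.flat_appLE U.2 hV le_rfl
  · intro p
    obtain ⟨x, hx⟩ := f.surjective (U.2.fromSpec p)
    have hxV : x ∈ f ⁻¹ᵁ U := by
      change f x ∈ (U.1 : Set Y)
      rw [hx, ← U.2.range_fromSpec]
      exact ⟨p, rfl⟩
    obtain ⟨q, hq⟩ : x ∈ Set.range hV.fromSpec := by
      rw [IsAffineOpen.range_fromSpec]
      exact hxV
    refine ⟨q, ?_⟩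
    apply U.2.fromSpec.isOpenEmbedding.injective
    change (Spec.map (f.app U) ≫ U.2.fromSpec) q = _
    rw [Scheme.Hom.app_eq_appLE, IsAffineOpen.SpecMap_appLE_fromSpec f U.2 hV le_rfl,
      Scheme.Hom.comp_apply, hq, hx]

/-- Faithfully flat descent of ideals on affine opens: for `f : X → Y` flat surjective affine,
`J(U)` is the contraction of `J(U)·Γ(X, f⁻¹U)`. [folklore] -/
theorem ideal_eq_comap_ideal_comap (f : X ⟶ Y) [IsAffineHom f] [Flat f] [Surjective f]
    (J : Y.IdealSheafData) (U : Y.affineOpens) :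
    J.ideal U = ((J.comap f).ideal ⟨f ⁻¹ᵁ U, U.2.preimage f⟩).comap (f.app U).hom := by
  rw [ideal_comap_preimage_of_isAffineHom]
  letI := (f.app U).hom.toAlgebra
  have : Module.FaithfullyFlat Γ(Y, U) Γ(X, f ⁻¹ᵁ U) :=
    (RingHom.faithfullyFlat_algebraMap_iff).mp (faithfullyFlat_app f U)
  exact (Ideal.comap_map_eq_self_of_faithfullyFlat (B := Γ(X, f ⁻¹ᵁ U)) (J.ideal U)).symm

/-- Pulling back ideal sheaves along a flat surjective affine morphism is injective
(`IB ∩ A = I`). [folklore] -/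
theorem comap_injective (f : X ⟶ Y) [IsAffineHom f] [Flat f] [Surjective f]
    {J J' : Y.IdealSheafData} (h : J.comap f = J'.comap f) : J = J' := by
  ext U : 2
  rw [ideal_eq_comap_ideal_comap f J U, ideal_eq_comap_ideal_comap f J' U, h]

/-- Pulling back ideal sheaves along a flat surjective affine morphism reflects the order.
[folklore] -/
theorem le_of_comap_le_comap (f : X ⟶ Y) [IsAffineHom f] [Flat f] [Surjective f]
    {J J' : Y.IdealSheafData} (h : J.comap f ≤ J'.comap f) : J ≤ J' := by
  have : (J ⊔ J').comap f = J'.comap f := by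
    rw [comap_sup]
    exact sup_eq_right.mpr h
  rw [← sup_eq_right]
  exact comap_injective f this

/-- An ideal sheaf whose pullback along a flat surjective affine morphism is zero is zero.
[folklore] -/
theorem eq_bot_of_comap_eq_bot (f : X ⟶ Y) [IsAffineHom f] [Flat f] [Surjective f]
    {J : Y.IdealSheafData} (h : J.comap f = ⊥) : J = ⊥ :=
  comap_injective f (h.trans (comap_bot f).symm)

/-- Radicality descends along a flat surjective affine morphism: if `J·𝒪_X` is a radical ideal
sheaf then so is `J`. [folklore] -/
theorem radical_eq_of_comap (f : X ⟶ Y) [IsAffineHom f] [Flat f] [Surjective f]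
    {J : Y.IdealSheafData} (h : (J.comap f).radical = J.comap f) : J.radical = J := by
  refine le_antisymm ?_ J.le_radical
  intro U g hg
  rw [radical_ideal] at hg
  obtain ⟨n, hn⟩ := hg
  rw [ideal_eq_comap_ideal_comap f J U, Ideal.mem_comap]
  have h1 : (f.app U).hom g ^ n ∈ (J.comap f).ideal ⟨f ⁻¹ᵁ U, U.2.preimage f⟩ := by
    rw [← map_pow, ideal_comap_preimage_of_isAffineHom]
    exact Ideal.mem_map_of_mem _ hn
  have h2 : (f.app U).hom g ∈ ((J.comap f).radical).ideal ⟨f ⁻¹ᵁ U, U.2.preimage f⟩ := by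
    rw [radical_ideal]
    exact ⟨n, h1⟩
  rwa [h] at h2

/-- The support of an ideal sheaf is the image of the support of its pullback along a
surjective morphism. [folklore] -/
theorem image_support_comap (f : X ⟶ Y) [Surjective f] (J : Y.IdealSheafData) :
    f '' ((J.comap f).support : Set X) = J.support := by
  rw [support_comap]
  exact Set.image_preimage_eq _ f.surjective

/-- A radical ideal sheaf is the vanishing ideal of its support. [folklore] -/
theorem eq_vanishingIdeal_support {J : Y.IdealSheafData} (h : J.radical = J) :
    J = vanishingIdeal J.support := by
  rw [vanishingIdeal_support, h]

/-- For a closed immersion `c`, every ideal sheaf on the source is the pullback of its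
pushforward. [folklore] -/
theorem comap_map_of_isClosedImmersion (c : X ⟶ Y) [IsClosedImmersion c]
    (I : X.IdealSheafData) : (I.map c).comap c = I := by
  refine ext_of_iSup_eq_top (fun U : Y.affineOpens => ⟨c ⁻¹ᵁ U, U.2.preimage c⟩) ?_ ?_
  · rw [← Scheme.Hom.preimage_iSup, iSup_affineOpens_eq_top]
    rfl
  · intro U
    rw [ideal_comap_preimage_of_isAffineHom, ideal_map_of_isAffineHom,
      Ideal.map_comap_of_surjective _ (c.app_surjective U U.2)]

/-- For a closed immersion `c : X → Y` and a closed `D ⊆ X`, the ideal sheaf of (the reduced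
structure on) `D` is the pullback of the ideal sheaf of `c(D)`. [folklore] -/
theorem comap_vanishingIdeal_image_of_isClosedImmersion (c : X ⟶ Y) [IsClosedImmersion c]
    (D : Closeds X) :
    (vanishingIdeal ⟨c '' D, c.isClosedEmbedding.isClosedMap _ D.2⟩).comap c =
      vanishingIdeal D := by
  have h := comap_map_of_isClosedImmersion c (vanishingIdeal D)
  rw [map_vanishingIdeal] at h
  convert h using 3
  ext1
  exact (c.isClosedEmbedding.isClosedMap _ D.2).closure_eq.symm

end IdealSheaves


end Literature.AlgebraicGeometry.Resolution

end
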